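import Literature.AlgebraicGeometry.Resolution.BlowupFibreConeModel
import Literature.AlgebraicGeometry.Resolution.BennettDimOneSharp
import Literature.AlgebraicGeometry.Resolution.FiniteNormalizationGRing
import Literature.AlgebraicGeometry.Resolution.BennettDimOne
import Literature.RingTheory.HilbertSamuel.HypersurfaceSection
import Mathlib.RingTheory.Jacobson.Ring
import HarnessLib

/-!
# Bennett–Hironaka–Singh for a permissible centre, in the local rings
# (Cossart–Jannsen–Saito 2020, Thm. 3.10 (1); Hironaka [H4] (4.1); HIO Thm. (31.1))

Topic: `Literature/AlgebraicGeometry/Resolution`. The ring-level content of CJS Thm. 3.10 (1) for an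
ARBITRARY permissible centre, in ALL characteristics and at ALL points of the fibre. Let
`(𝒪, 𝔫, k)` be a Noetherian local ring, `𝔭 = (c₁, …, c_n)` a permissible ideal (`𝒪/𝔭` regular of
dimension `s`, `𝒪` normally flat along `𝔭`), `C = 𝒪[𝔭/c_j]` a chart of the blowing up of `𝔭`,
`P ⊆ C` a prime over `𝔫` and `𝒪' = C_P` (the local ring of `X' = Bl_𝔭` at a point `x'` of the
fibre). For every strict chain of primes `P = P₀ ⊊ ⋯ ⊊ P_ℓ` of `C` (e.g. `ℓ = 0`; for `x'` closed
in the fibre of dimension `δ` above the image… in general `ℓ` realises `δ = trdeg κ(x')/k`):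

* `hilbertSamuelFun_add_length_le_of_isPermissible` — **`H^{(i+ℓ)}[𝒪'] ≤ H^{(i)}[𝒪]` for all
  `i`** (CJS (3.14): `H^{(1+δ)}_{𝒪'} ≤ H^{(2+δ+s)}_{𝒪_{F,x'}} = H^{(2+δ+s)}_{A_𝔓} ≤ H^{(1+s)}_{C} =
  H^{(1)}_{𝒪}`, here with the SHARP Bennett inequality (HIO (30.2), Singh) in the local ring of
  the cone at its vertex — which contains the field `k` in every characteristic — so that the
  printed `H^{(δ)}[𝒪'] ≤ H^{(0)}[𝒪]` (`i = 0`) is obtained);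
* `exists_ltSeries_minimalPrimesCodim_le` — for `𝒪` universally catenary there is such a chain
  with **`ψ(𝒪) ≤ ψ(𝒪') + ℓ`** (CJS (3.7)–(3.8): `φ_{X'}(x') ≤ φ_X(x) + δ`), namely a saturated
  chain from `P` to a maximal ideal `M' ⊇ P` (dimension formula at the residually finite `M'`,
  `PsiBirationalChart.lean`, and catenarity of `C`);
* `hilbertSamuelFun_sub_minimalPrimesCodim_le_of_isPermissible` — hence
  **`H^{(N-ψ(𝒪'))}[𝒪'] ≤ H^{(N-ψ(𝒪))}[𝒪]` for every `N`** (CJS (3.9)).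

The scheme-level statement (`Scheme.hsFun`) is assembled in `PermissibleBlowupHilbertSamuel.lean`.
No named facts are introduced.

## Sources

* V. Cossart, U. Jannsen, S. Saito, LNM 2270 (2020), Thm. 3.10 (1) and its proof,
  (3.7)–(3.9), (3.14), Remark 3.12. [CossartJannsenSaito2020]
* M. Herrmann, S. Ikeda, U. Orbanz, *Equimultiplicity and Blowing up* (1988), Thm. (30.2),
  Thm. (31.1), Cor. (31.2). [HerrmannIkedaOrbanz1988]
* B. Singh, *Effect of a permissible blowing-up on the local Hilbert functions*, Invent. Math. 26
  (1974), 201–212 (the sharp form). Background.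
-/

noncomputable section

open Polynomial IsLocalRing Literature.RingTheory.HilbertSamuel

namespace Literature.AlgebraicGeometry.Resolution

universe u

/-! ## Residual finiteness at maximal ideals of the chart (Zariski's lemma) -/

/-- **A maximal ideal `M'` of a finitely generated algebra `C` over a local ring `(𝒪, 𝔫)` lying
over `𝔫` is residually finite**: every `b ∈ C` satisfies a monic equation over `𝒪` modulo `M'`
(`C/M'` is a field finitely generated over the field `𝒪/𝔫`, hence finite: Zariski's lemma).
[cite: StacksProject, Tag 00GB] -/
theorem exists_monic_eval₂_mem_of_isMaximal {O C : Type u} [CommRing O] [IsLocalRing O] [CommRing C]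
    [Algebra O C] [Algebra.FiniteType O C] (M' : Ideal C) [M'.IsMaximal]
    (hM' : M'.comap (algebraMap O C) = maximalIdeal O) (b : C) :
    ∃ f : O[X], f.Monic ∧ f.eval₂ (algebraMap O C) b ∈ M' := by
  letI := Ideal.Quotient.field M'
  -- `k = 𝒪/𝔫 → C/M'`
  let ι : ResidueField O →+* C ⧸ M' :=
    Ideal.Quotient.lift (maximalIdeal O) ((Ideal.Quotient.mk M').comp (algebraMap O C))
      fun r hr => by
        rw [RingHom.comp_apply, Ideal.Quotient.eq_zero_iff_mem, ← Ideal.mem_comap, hM']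
        exact hr
  letI : Algebra (ResidueField O) (C ⧸ M') := ι.toAlgebra
  haveI : IsScalarTower O (ResidueField O) (C ⧸ M') := IsScalarTower.of_algebraMap_eq fun r => rfl
  haveI : Algebra.FiniteType (ResidueField O) (C ⧸ M') :=
    Algebra.FiniteType.of_restrictScalars_finiteType O (ResidueField O) (C ⧸ M')
  haveI : Module.Finite (ResidueField O) (C ⧸ M') :=
    finite_of_finite_type_of_isJacobsonRing (ResidueField O) (C ⧸ M')
  have hint : IsIntegral (ResidueField O) (Ideal.Quotient.mk M' b) := Algebra.IsIntegral.isIntegral _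
  obtain ⟨g, hgmonic, hg⟩ := hint
  obtain ⟨f, hfg, -, hfmonic⟩ := Polynomial.lifts_and_natDegree_eq_and_monic
    ((Polynomial.mem_lifts g).mpr (Polynomial.map_surjective (residue O) residue_surjective g)) hgmonic
  refine ⟨f, hfmonic, ?_⟩
  rw [← Ideal.Quotient.eq_zero_iff_mem, Polynomial.hom_eval₂]
  have hcomp : (Ideal.Quotient.mk M').comp (algebraMap O C) = ι.comp (residue O) :=
    RingHom.ext fun r => rfl
  rw [hcomp, ← Polynomial.eval₂_map, hfg]
  exact hg

/-! ## Chains in a catenary domain -/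

/-- In a catenary Noetherian domain, for primes `p ⊆ q` there is a strict chain of primes from `p`
to `q` of length `ht q - ht p` (a saturated chain; `ht` is additive along saturated chains from
`(0)`). [cite: Matsumura1987, §5 p. 31] -/
theorem exists_ltSeries_height_eq_add {B : Type u} [CommRing B] [IsNoetherianRing B] [IsDomain B]
    (hB : IsCatenaryRing B) {p q : Ideal B} [hp : p.IsPrime] [hq : q.IsPrime] (hpq : p ≤ q) :
    ∃ u : LTSeries (PrimeSpectrum B), u.head.asIdeal = p ∧ u.last.asIdeal = q ∧
      q.height = p.height + u.length := by
  let P₀ : PrimeSpectrum B := ⟨⊥, Ideal.isPrime_bot⟩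
  let P₁ : PrimeSpectrum B := ⟨p, hp⟩
  let P₂ : PrimeSpectrum B := ⟨q, hq⟩
  have h01 : P₀ ≤ P₁ := (bot_le : (⊥ : Ideal B) ≤ p)
  have h12 : P₁ ≤ P₂ := hpq
  obtain ⟨s₁, hs₁0, hs₁1, hs₁⟩ := exists_isSaturatedChain h01
  obtain ⟨u, hu1, hu2, hu⟩ := exists_isSaturatedChain h12
  have hconn : s₁.last = u.head := hs₁1.trans hu1.symm
  have hsat : IsSaturatedChain (s₁.smash u hconn) := forall_covBy_smash hconn hs₁ hu
  have hhtp : p.height = s₁.length := by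
    have h := hB.height_eq_length_of_isSaturatedChain s₁ hs₁ (by rw [hs₁0])
    rwa [hs₁1] at h
  have hhtq : q.height = (s₁.length + u.length : ℕ) := by
    have h := hB.height_eq_length_of_isSaturatedChain (s₁.smash u hconn) hsat
      (by rw [RelSeries.head_smash, hs₁0])
    rw [RelSeries.last_smash, hu2] at h
    rw [← RelSeries.smash_length s₁ u hconn]
    exact h
  refine ⟨u, by rw [hu1], by rw [hu2], ?_⟩
  rw [hhtq, hhtp, Nat.cast_add]

/-- **Chains above a prime, read in a quotient**: for `I ⊆ p ⊆ q` primes of `B` with `B/I` a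
catenary Noetherian domain, there is a strict chain of primes of `B` issuing from `p`, of length
`ℓ` with `ht(q/I) = ht(p/I) + ℓ`. [cite: Matsumura1987, §5 p. 31] -/
theorem exists_ltSeries_height_map_eq_add {B : Type u} [CommRing B] (I : Ideal B)
    [IsNoetherianRing (B ⧸ I)] [IsDomain (B ⧸ I)] (hB : IsCatenaryRing (B ⧸ I))
    {p q : Ideal B} [p.IsPrime] [q.IsPrime] (hIp : I ≤ p) (hpq : p ≤ q) :
    ∃ t : LTSeries (PrimeSpectrum B), t.head.asIdeal = p ∧
      (q.map (Ideal.Quotient.mk I)).height =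
        (p.map (Ideal.Quotient.mk I)).height + t.length := by
  haveI : (p.map (Ideal.Quotient.mk I)).IsPrime := isPrime_map_quotientMk_of_le hIp
  haveI : (q.map (Ideal.Quotient.mk I)).IsPrime := isPrime_map_quotientMk_of_le (hIp.trans hpq)
  obtain ⟨u, hu0, -, hht⟩ := exists_ltSeries_height_eq_add hB
    (p := p.map (Ideal.Quotient.mk I)) (q := q.map (Ideal.Quotient.mk I)) (Ideal.map_mono hpq)
  obtain ⟨F, -, -, hFx⟩ := exists_orderEmbedding_of_surjective (Ideal.Quotient.mk I)
    Ideal.Quotient.mk_surjective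
  refine ⟨u.map F F.strictMono, ?_, hht⟩
  rw [LTSeries.head_map, hFx]
  change (u.head.asIdeal).comap (Ideal.Quotient.mk I) = p
  rw [hu0, Ideal.comap_map_of_surjective _ Ideal.Quotient.mk_surjective,
    ← RingHom.ker_eq_comap_bot, Ideal.mk_ker, sup_eq_left]
  exact hIp

/-! ## The chart of a permissible blow-up: setting -/

section Chart

variable {O : Type u} [CommRing O] [IsLocalRing O] [IsNoetherianRing O] {n : ℕ} (c : Fin n → O)
  (j : Fin n)

local notation3 "𝔭" => Ideal.span (Set.range c)
local notation3 "hcj" => Ideal.mem_span_range_self (f := c) (x := j)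
local notation3 "𝒞" => HomogeneousLocalization.Away (reesGrading (Ideal.span (Set.range c)))
  (reesT (c j) (Ideal.mem_span_range_self (f := c) (x := j)))
local notation3 "φ" => reesChartBase (I := Ideal.span (Set.range c)) (c j)
  (Ideal.mem_span_range_self (f := c) (x := j))

variable (P : Ideal (HomogeneousLocalization.Away (reesGrading (Ideal.span (Set.range c)))
  (reesT (c j) (Ideal.mem_span_range_self (f := c) (x := j))))) [P.IsPrime]
variable (O' : Type u) [CommRing O']
  [Algebra (HomogeneousLocalization.Away (reesGrading (Ideal.span (Set.range c)))
    (reesT (c j) (Ideal.mem_span_range_self (f := c) (x := j)))) O']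
  [IsLocalization.AtPrime O' P] [IsLocalRing O'] [Algebra O O']

local notation3 "φ'" => (algebraMap (HomogeneousLocalization.Away (reesGrading (Ideal.span (Set.range c)))
  (reesT (c j) (Ideal.mem_span_range_self (f := c) (x := j)))) O' :
    HomogeneousLocalization.Away (reesGrading (Ideal.span (Set.range c)))
      (reesT (c j) (Ideal.mem_span_range_self (f := c) (x := j))) →+* O')
local notation3 "𝓝" => LocalizedPolynomial O'

omit [IsLocalRing O] [IsNoetherianRing O] in
/-- **`𝔭 𝒪'(X) = (c_j) 𝒪'(X)`**: on the chart the centre becomes principal. [cite: StacksProject, Tag 0804] -/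
theorem map_span_range_localizedPolynomial_eq
    (hOO' : ∀ r : O, algebraMap O O' r = φ' (φ r)) :
    (𝔭).map (algebraMap O 𝓝) = Ideal.span {algebraMap O 𝓝 (c j)} := by
  have hcomp : algebraMap O 𝓝 = ((algebraMap O' 𝓝).comp φ').comp φ := by
    refine RingHom.ext fun r => ?_
    rw [IsScalarTower.algebraMap_apply O O' 𝓝, hOO']
    rfl
  have h1 : (𝔭).map φ = Ideal.span {φ (c j)} := span_image_reesChartBase_eq (c j) hcj
  rw [hcomp, ← Ideal.map_map, ← Ideal.map_map, h1, Ideal.map_span, Set.image_singleton,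
    Ideal.map_span, Set.image_singleton]
  all_goals rfl

/-- **CJS (3.14), first half, on the chart: `H^{(i)}[𝒪'] ≤ H^{(i+s+1)}[𝒪'(X)/𝔫𝒪'(X)]`** when
`𝔫 = 𝔭 + (x₁, …, x_s)`: `H[𝒪'] = H[𝒪'(X)]` (Nagata) and `𝔫𝒪'(X) = (c_j, x₁, …, x_s)𝒪'(X)` has
`s + 1` generators (hypersurface sections, CJS Lemma 2.24 ff.).
[cite: CossartJannsenSaito2020, Thm. 3.10 (proof, (3.14))] -/
theorem hilbertSamuelFun_le_localizedPolynomial_quotient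
    (hP : P.comap φ = maximalIdeal O) (hOO' : ∀ r : O, algebraMap O O' r = φ' (φ r))
    {s : ℕ} (x : Fin s → O) (hx : maximalIdeal O = 𝔭 ⊔ Ideal.span (Set.range x)) (i : ℕ) :
    haveI := isLocalRing_localizedPolynomial_quotient (c j) hcj P O' hP hOO'
    hilbertSamuelFun O' i ≤
      hilbertSamuelFun (𝓝 ⧸ (maximalIdeal O).map (algebraMap O 𝓝)) (i + (s + 1)) := by
  haveI := isLocalRing_localizedPolynomial_quotient (c j) hcj P O' hP hOO'
  haveI := isNoetherianRing_chart c j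
  haveI : IsNoetherianRing O' := IsLocalization.isNoetherianRing P.primeCompl O' inferInstance
  -- `H[𝒪'] = H[𝒪'(X)]`
  have h0 : hilbertSamuelFun O' i = hilbertSamuelFun 𝓝 i := by
    change iterPSum i (hilbertFun O') = iterPSum i (hilbertFun 𝓝)
    rw [hilbertFun_localizedPolynomial]
  rw [h0]
  -- the `s + 1` generators `c_j, x_1, …, x_s` of `𝔫 𝒪'(X)`
  let t : Fin (s + 1) → 𝓝 := Fin.cons (algebraMap O 𝓝 (c j)) fun k => algebraMap O 𝓝 (x k)
  have hle := map_maximalIdeal_localizedPolynomial_le (c j) hcj P O' hP hOO'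
  have hcj𝔫 : c j ∈ maximalIdeal O := by
    rw [hx]; exact Ideal.mem_sup_left hcj
  have hx𝔫 : ∀ k, x k ∈ maximalIdeal O := fun k => by
    rw [hx]; exact Ideal.mem_sup_right (Ideal.subset_span ⟨k, rfl⟩)
  have ht : ∀ k, t k ∈ maximalIdeal 𝓝 := fun k => by
    refine Fin.cases ?_ (fun k => ?_) k
    · simp only [t, Fin.cons_zero]
      exact hle (Ideal.mem_map_of_mem _ hcj𝔫)
    · simp only [t, Fin.cons_succ]
      exact hle (Ideal.mem_map_of_mem _ (hx𝔫 k))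
  have hK' : (maximalIdeal O).map (algebraMap O 𝓝) ≤ Ideal.span (Set.range t) := by
    rw [hx, Ideal.map_sup, map_span_range_localizedPolynomial_eq c j O' hOO', Ideal.map_span]
    refine sup_le ?_ ?_
    · rw [Ideal.span_singleton_le_iff_mem]
      exact Ideal.subset_span ⟨0, by simp only [t, Fin.cons_zero]⟩
    · rw [Ideal.span_le]
      rintro _ ⟨_, ⟨k, rfl⟩, rfl⟩
      exact Ideal.subset_span ⟨k.succ, by simp only [t, Fin.cons_succ]⟩
  -- (the surjectivity and kernel goals are discharged inline: stating them separately makes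
  -- the elaborator search `Algebra 𝒪'(X) (𝒪'(X)/𝔫)` from scratch, which is very slow)
  refine hilbertSamuelFun_le_of_ker_le_span_range (A := 𝓝)
    (B := 𝓝 ⧸ (maximalIdeal O).map (algebraMap O 𝓝)) ?_ t ht ?_ i
  · rw [Ideal.Quotient.algebraMap_eq]; exact Ideal.Quotient.mk_surjective
  · rw [Ideal.Quotient.algebraMap_eq, Ideal.mk_ker]; exact hK'

/-- **Bennett–Hironaka–Singh along a permissible centre, at every point of the fibre, every
characteristic: `H^{(i+ℓ)}[𝒪'] ≤ H^{(i)}[𝒪]`** for every strict chain of primes of length `ℓ`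
issuing from `P` in the chart (CJS (3.14) = HIO (31.1) with the sharp Bennett inequality (30.2)
applied in the local ring of the cone `C_{X,D,x} = Spec(gr_𝔭(𝒪) ⊗ k)` at its vertex, which
contains the field `k`). [cite: CossartJannsenSaito2020, Thm. 3.10 (1) (proof, (3.14))]
[cite: HerrmannIkedaOrbanz1988, Cor. (31.2) (c)] -/
theorem hilbertSamuelFun_add_length_le_of_isPermissible [(𝔭).IsPrime]
    [IsRegularLocalRing (O ⧸ 𝔭)] {s : ℕ} (hs : ringKrullDim (O ⧸ 𝔭) = s)
    (hNF : (𝔭).IsNormallyFlat) (hP : P.comap φ = maximalIdeal O)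
    (hOO' : ∀ r : O, algebraMap O O' r = φ' (φ r))
    (t : LTSeries (PrimeSpectrum 𝒞)) (ht : t.head.asIdeal = P) (i : ℕ) :
    hilbertSamuelFun O' (i + t.length) ≤ hilbertSamuelFun O i := by
  haveI := isLocalRing_localizedPolynomial_quotient (c j) hcj P O' hP hOO'
  haveI hq := isPrime_coneLocalPrime (c j) hcj P hP
  obtain ⟨x, hx⟩ := exists_maximalIdeal_eq_sup_span_range (𝔭) hs
  set ℓ := t.length
  set R := FibreConeLocal (𝔭)
  set q := coneLocalPrime (c j) hcj P
  -- (3.14), first half, and the model `𝒪'(X)/𝔫 ≅ R_q`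
  have h1 := hilbertSamuelFun_le_localizedPolynomial_quotient c j P O' hP hOO' x hx (i + ℓ)
  rw [hilbertSamuelFun_localizedPolynomial_quotient_eq (c j) hcj P O' hP hOO'] at h1
  -- Bennett (30.2), sharp, in `R` (contains `k`, is a G-ring) at `q`, `dim R/q = d ≥ ℓ + 1`
  obtain ⟨d, hd⟩ := Literature.RingTheory.HilbertSamuel.exists_ringKrullDim_quotient_eq_nat R q
  have hℓd : ℓ + 1 ≤ d := by
    have h := length_succ_le_ringKrullDim_fibreConeLocal_quotient (c j) hcj P hP t ht
    rw [hd] at h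
    exact_mod_cast h
  have hG : IsGRing R := isGRing_fibreConeLocal (𝔭)
  have hB : ∀ s', hilbertSamuelFun (Localization.AtPrime q) (s' + d) ≤ hilbertSamuelFun R s' :=
    hilbertSamuelFun_add_le_of_ringKrullDim_quotient_eq_of_ringHom_field
      (fibreConeLocalResidueMap (𝔭)) (fun q' Q _ _ hqQ hadj _ =>
        module_finite_integralClosure_range_localization_quotient_of_isGRing hG Q _
          (ringKrullDim_localization_quotient_map_eq_one hqQ hadj)) d q hd
  -- index bookkeeping: `H[R_q](i+ℓ+s+1) ≤ H[R_q]((i+ℓ+s+1-d)+d) ≤ H[R](i+ℓ+s+1-d) ≤ H[R](i+s)`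
  have h2 : hilbertSamuelFun (Localization.AtPrime q) (i + ℓ + (s + 1)) ≤
      hilbertSamuelFun R (i + s) :=
    calc hilbertSamuelFun (Localization.AtPrime q) (i + ℓ + (s + 1))
        ≤ hilbertSamuelFun (Localization.AtPrime q) ((i + ℓ + (s + 1) - d) + d) :=
          hilbertSamuelFun_mono (by omega)
      _ ≤ hilbertSamuelFun R (i + ℓ + (s + 1) - d) := hB _
      _ ≤ hilbertSamuelFun R (i + s) := hilbertSamuelFun_mono (by omega)
  -- the vertex: `H^{(i+s)}[R] ≤ H^{(i)}[𝒪]` (normal flatness + regular centre)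
  have h3 := hilbertSamuelFun_fibreConeLocal_add_le (𝔭) hs hNF i
  exact h1.trans (h2.trans h3)

/-! ## `ψ(𝒪) ≤ ψ(𝒪') + ℓ` for a chain from `P` to a closed point of the fibre -/

omit [Algebra O O'] in
-- (`maxHeartbeats`: matching the height `ht(M'/Q')` produced by the dimension formula of
-- `PsiBirationalChart.lean` against the one produced here makes the kernel compare two instance
-- paths to `Semiring (C/Q')`, `C` a homogeneous localization; this is correct but slow)
set_option maxHeartbeats 400000 in
/-- **CJS (3.7)–(3.8) at an arbitrary point of the fibre: `ψ(𝒪) ≤ ψ(𝒪') + ℓ`** for a suitable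
strict chain of primes `P = P₀ ⊊ ⋯ ⊊ P_ℓ` of the chart (`𝒪` universally catenary). Proof: take a
minimal prime `Q''` of `𝒪'` with `dim 𝒪'/Q'' = ψ(𝒪')`, `Q' = Q'' ∩ C` (minimal, `⊆ P`),
`Q = Q' ∩ 𝒪` (minimal); a maximal ideal `M' ⊇ P` is residually finite over `𝔫` (Zariski), so the
dimension formula gives `dim 𝒪/Q = ht(M'/Q')`; in the catenary domain `C/Q'` a saturated chain
`0 ⊊ ⋯ ⊊ P/Q'` (length `ht(P/Q') = dim 𝒪'/Q''`) followed by a saturated chain `P/Q' ⊊ ⋯ ⊊ M'/Q'`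
(length `ℓ`) computes `ht(M'/Q') = ψ(𝒪') + ℓ ≥ ψ(𝒪)`.
[cite: CossartJannsenSaito2020, Thm. 3.10 (1) (proof, (3.7)–(3.8)), Remark 3.12] -/
theorem exists_ltSeries_minimalPrimesCodim_le (hO : IsUniversallyCatenaryRing O)
    (hP : P.comap φ = maximalIdeal O) :
    ∃ t : LTSeries (PrimeSpectrum 𝒞), t.head.asIdeal = P ∧
      minimalPrimesCodim O ≤ minimalPrimesCodim O' + t.length := by
  classical
  -- the chart as an `𝒪`-algebra inside `S = 𝒪[1/c_j]`
  letI algOC : Algebra O 𝒞 := (φ).toAlgebra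
  letI algCS : Algebra 𝒞 (Localization.Away (c j)) := (reesChart (c j) hcj).toAlgebra
  haveI hT2 := IsScalarTower.of_algebraMap_eq (R := O) (S := 𝒞) (A := Localization.Away (c j))
    fun r => (reesChart_reesChartBase (c j) hcj r).symm
  haveI : Algebra.FiniteType O 𝒞 := finiteType_chart c j
  haveI : IsNoetherianRing 𝒞 := isNoetherianRing_chart c j
  haveI : IsNoetherianRing O' := IsLocalization.isNoetherianRing P.primeCompl O' inferInstance
  haveI : IsLocalRing O' := inferInstance
  haveI : P.LiesOver (maximalIdeal O) := ⟨hP.symm⟩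
  have hinj : Function.Injective (algebraMap 𝒞 (Localization.Away (c j))) :=
    reesChart_injective (c j) hcj
  -- `Q''`, `Q'`, `Q`
  obtain ⟨Q'', hQ'', hdim''⟩ := exists_minimalPrimes_ringKrullDim_eq_minimalPrimesCodim O'
  obtain ⟨hQ'min, hQ'P, hQ'map⟩ :=
    under_mem_minimalPrimes_and_le_of_mem_minimalPrimes_localization 𝒞 P O' hQ''
  set Q' : Ideal 𝒞 := Q''.under 𝒞
  haveI hQ'prime : Q'.IsPrime := hQ'min.1.1
  have hQmin : Q'.under O ∈ minimalPrimes O :=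
    under_mem_minimalPrimes_of_mem_minimalPrimes (Submonoid.powers (c j)) (Localization.Away (c j))
      𝒞 hinj hQ'min
  -- a closed point `M' ⊇ P` of the fibre, residually finite
  obtain ⟨M', hM'max, hPM'⟩ := Ideal.exists_le_maximal P (Ideal.IsPrime.ne_top inferInstance)
  haveI := hM'max
  have hM'over : M'.comap φ = maximalIdeal O := comap_reesChartBase_eq_of_le (c j) hcj hP hPM'
  haveI : M'.LiesOver (maximalIdeal O) := ⟨hM'over.symm⟩
  have hres : ∀ b : 𝒞, ∃ f : O[X], f.Monic ∧ f.eval₂ (algebraMap O 𝒞) b ∈ M' :=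
    exists_monic_eval₂_mem_of_isMaximal M' hM'over
  have hQ'M' : Q' ≤ M' := hQ'P.trans hPM'
  -- the dimension formula at `M'` and the localization formula at `P`
  have hdimO : ((M'.map (Ideal.Quotient.mk Q')).height : WithBot ℕ∞) =
      ringKrullDim (O ⧸ Q'.under O) :=
    height_map_eq_height_of_mem_minimalPrimes (Submonoid.powers (c j)) (Localization.Away (c j)) 𝒞
      M' hO hinj hres hQ'min hQ'M'
  have hdimO' : ringKrullDim (O' ⧸ Q'') = (P.map (Ideal.Quotient.mk Q')).height := by
    rw [← hQ'map]
    exact ringKrullDim_quotient_map_eq_height 𝒞 P O' hQ'P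
  -- chains in the catenary domain `C/Q'`: `ht(M'/Q') = ht(P/Q') + ℓ`, `ℓ` the length of a chain
  -- `P = P₀ ⊊ ⋯ ⊊ P_ℓ = M'` of `C`
  have hC : IsCatenaryRing (𝒞 ⧸ Q') := (hO.isCatenaryRing_of_finiteType 𝒞).quotient Q'
  haveI : IsDomain (𝒞 ⧸ Q') := Ideal.Quotient.isDomain Q'
  obtain ⟨t, ht0, hht⟩ := exists_ltSeries_height_map_eq_add Q' hC hQ'P hPM'
  refine ⟨t, ht0, ?_⟩
  -- `ψ(𝒪) ≤ dim 𝒪/Q = ht(M'/Q') = ht(P/Q') + ℓ = ψ(𝒪') + ℓ`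
  have hhtP : (P.map (Ideal.Quotient.mk Q')).height = minimalPrimesCodim O' := by
    have h := hdimO'.symm.trans hdim''
    exact_mod_cast h
  have hn : ringKrullDim (O ⧸ Q'.under O) =
      ((minimalPrimesCodim O' + t.length : ℕ) : WithBot ℕ∞) := by
    rw [← hdimO, hht, hhtP]
    norm_cast
  exact minimalPrimesCodim_le O hQmin hn

/-- **CJS Thm. 3.10 (1), third inequality, in the local rings, for a permissible centre:
`H^{(N-ψ(𝒪'))}[𝒪'] ≤ H^{(N-ψ(𝒪))}[𝒪]` for every `N`** (`𝒪` universally catenary Noetherian local,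
`𝔭 = (c₁, …, c_n)` permissible, `𝒪' = C_P` the local ring of the blow-up at a point of the fibre —
any point, any characteristic). [cite: CossartJannsenSaito2020, Thm. 3.10 (1) (proof, (3.9))] -/
theorem hilbertSamuelFun_sub_minimalPrimesCodim_le_of_isPermissible (hO : IsUniversallyCatenaryRing O)
    [(𝔭).IsPrime] [IsRegularLocalRing (O ⧸ 𝔭)] (hNF : (𝔭).IsNormallyFlat)
    (hP : P.comap φ = maximalIdeal O) (hOO' : ∀ r : O, algebraMap O O' r = φ' (φ r)) (N : ℕ) :
    hilbertSamuelFun O' (N - minimalPrimesCodim O') ≤ hilbertSamuelFun O (N - minimalPrimesCodim O) := by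
  obtain ⟨s, hs⟩ := Literature.RingTheory.HilbertSamuel.exists_ringKrullDim_quotient_eq_nat O (𝔭)
  obtain ⟨t, ht, hψ⟩ := exists_ltSeries_minimalPrimesCodim_le c j P O' hO hP
  have h := hilbertSamuelFun_add_length_le_of_isPermissible c j P O' hs hNF hP hOO' t ht
    (N - minimalPrimesCodim O)
  exact (hilbertSamuelFun_mono (by omega)).trans h

end Chart

end Literature.AlgebraicGeometry.Resolution

end
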